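import Literature.AlgebraicGeometry.Smoothening.NeronDefect
import Mathlib.Algebra.Module.PID
import Mathlib.LinearAlgebra.FreeModule.PID
import Mathlib.LinearAlgebra.TensorProduct.RightExactness
import Mathlib.RingTheory.DiscreteValuationRing.Basic
import Mathlib.RingTheory.Flat.Basic
import Mathlib.RingTheory.LocalRing.Length
import Mathlib.RingTheory.TensorProduct.Free
import HarnessLib

/-!
# Néron's measure for the defect of smoothness over a discrete valuation ring

Topic: `Literature/AlgebraicGeometry/Smoothening`; sequel of `NeronDefect.lean`. There
`δ(a) = length_{R'} tors(R' ⊗_A Ω[A⁄R])` was defined for an arbitrary `A`-algebra `R'`. In the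
smoothening process (Bosch–Lütkebohmert–Raynaud, *Néron Models*, §3.3; M. Artin, *Néron Models*,
(3.8)) `R'` is a discrete valuation ring — `R` itself, an étale local extension, the strict
henselisation `R^sh` — and `a*Ω¹_{X/R}` is a finitely generated `R'`-module. This file PROVES
the module-theoretic facts about such `δ` which the process uses:

* `length_torsion_ne_top`, `neronDefect_ne_top` — **`δ(a)` is finite** (Artin: "bounded above
  for all points `x'`" needs at least this): the torsion of a finitely generated module over a
  discrete valuation ring `S` is `⨁ S/𝔪^{eᵢ}`, of length `Σ eᵢ` (`exists_length_torsion_eq_sum`);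
* `free_iff_torsion_eq_bot`, `neronDefect_eq_zero_iff_free` — **`δ(a) = 0` iff `a*Ω¹` is free**
  (finitely generated modules over a principal ideal domain);
* `torsion_baseChange_eq_range`, `length_torsion_baseChange`, `neronDefect_baseChange`,
  `neronDefect_eq_of_map_maximalIdeal_eq` — **`δ` is unchanged under local extensions `R' → R''`
  of ramification index one** (flat local homomorphisms with `𝔪' R'' = 𝔪''`, e.g. `R → R^sh`,
  `R →` completion; BLR 3.3, `δ` "is compatible with" such extensions, which is what makes the
  passage between `R`-, `R^sh`- and `R̂`-valued points in §§3.3–3.6 possible): by flatness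
  `tors(R'' ⊗ M) = R'' ⊗ tors(M)`, and Mathlib's `IsLocalRing.length_baseChange`
  (`length_{R''}(R'' ⊗ T) = length_{R'}(T) · length(R''/𝔪'R'')`).

No named facts are introduced (D-0026).

## References

* S. Bosch, W. Lütkebohmert, M. Raynaud, *Néron Models*, Springer 1990, §3.3.
  [BLRNeronModels1990] (Not held; section number only.)
* M. Artin, *Néron Models*, in Cornell–Silverman (eds.), *Arithmetic Geometry*, Springer 1986,
  (3.8) (p. 226). [Artin1986NeronModels]
-/

noncomputable section

open scoped TensorProduct DirectSum
open KaehlerDifferential IsLocalRing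

namespace Literature.AlgebraicGeometry.Smoothening

universe u v w w'

/-! ### Torsion of finitely generated modules over a principal ideal domain / discrete valuation ring -/

section PID

variable {S : Type u} [CommRing S] [IsDomain S] [IsPrincipalIdealRing S]
  {M : Type v} [AddCommGroup M] [Module S M] [Module.Finite S M]

/-- Over a principal ideal domain a finitely generated module is free iff its torsion submodule
vanishes. [folklore] -/
theorem free_iff_torsion_eq_bot : Module.Free S M ↔ Submodule.torsion S M = ⊥ := by
  rw [Module.free_iff_isTorsionFree, Submodule.isTorsionFree_iff_torsion_eq_bot]

/-- The torsion submodule of a finitely generated module over a Noetherian ring is finitely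
generated. [folklore] -/
instance finite_torsion : Module.Finite S (Submodule.torsion S M) :=
  Module.Finite.iff_fg.mpr (IsNoetherian.noetherian _)

/-- The quotient of a finitely generated module over a principal ideal domain by its torsion is
free. [folklore] -/
instance free_quotient_torsion : Module.Free S (M ⧸ Submodule.torsion S M) :=
  Module.free_of_finite_type_torsion_free'

/-- A finitely generated torsion module over a domain is killed by one non-zero element. [folklore] -/
theorem exists_ne_zero_forall_smul_torsion_eq_zero :
    ∃ a : S, a ≠ 0 ∧ ∀ x : Submodule.torsion S M, a • x = 0 := by
  obtain ⟨a, ha, ha0⟩ := Submodule.annihilator_top_inter_nonZeroDivisors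
    (Submodule.torsion_isTorsion (R := S) (M := M))
  exact ⟨a, nonZeroDivisors.ne_zero ha0, fun x => Submodule.mem_annihilator.mp ha x trivial⟩

end PID

section DVR

variable {S : Type u} [CommRing S] [IsDomain S] [IsDiscreteValuationRing S]
  {M : Type v} [AddCommGroup M] [Module S M] [Module.Finite S M]

/-- Over a discrete valuation ring `S`, `S ∙ p^e = 𝔪^e` for an irreducible `p`. [folklore] -/
theorem span_pow_irreducible_eq {p : S} (hp : Irreducible p) (e : ℕ) :
    (S ∙ p ^ e : Submodule S S) = (maximalIdeal S ^ e : Ideal S) := by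
  rw [(IsDiscreteValuationRing.irreducible_iff_uniformizer p).mp hp, Ideal.span_singleton_pow]

/-- **The torsion of a finitely generated module over a discrete valuation ring has finite
length `Σ eᵢ`**, where `tors M ≅ ⨁ S/𝔪^{eᵢ}` (structure theorem). [folklore] -/
theorem exists_length_torsion_eq_sum :
    ∃ (ι : Type u) (_ : Fintype ι) (e : ι → ℕ),
      Module.length S (Submodule.torsion S M) = ∑ i, (e i : ℕ∞) := by
  obtain ⟨ι, hι, p, hp, e, ⟨f⟩⟩ := Module.equiv_directSum_of_isTorsion
    (Submodule.torsion_isTorsion (R := S) (M := M))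
  refine ⟨ι, hι, e, ?_⟩
  rw [f.length_eq, (DirectSum.linearEquivFunOnFintype S ι _).length_eq, Module.length_pi_of_fintype]
  refine Finset.sum_congr rfl fun i _ => ?_
  rw [span_pow_irreducible_eq (hp i) (e i)]
  exact IsDiscreteValuationRing.length_quotient_pow_maximalIdeal S (e i)

/-- The torsion of a finitely generated module over a discrete valuation ring has finite length. [folklore] -/
theorem length_torsion_ne_top : Module.length S (Submodule.torsion S M) ≠ ⊤ := by
  obtain ⟨ι, _, e, h⟩ := exists_length_torsion_eq_sum (S := S) (M := M)
  rw [h, ← Nat.cast_sum]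
  exact ENat.coe_ne_top _

end DVR

/-! ### Torsion under flat base change -/

section BaseChange

variable {S : Type u} [CommRing S] [IsDomain S] [IsPrincipalIdealRing S]
  {S'' : Type w} [CommRing S''] [IsDomain S''] [Algebra S S'']
  (hinj : Function.Injective (algebraMap S S''))
  {M : Type v} [AddCommGroup M] [Module S M] [Module.Finite S M]

include hinj in
/-- **Torsion under base change** (for finitely generated modules over a principal ideal domain
`S` and a domain `S''` over `S` into which `S` injects): `tors(S'' ⊗_S M)` is the image of
`S'' ⊗_S tors(M)`. Indeed `T → M → F → 0` with `F = M/T` free stays exact after `S'' ⊗_S –`,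
`S'' ⊗ F` is free, and `S'' ⊗ T` is killed by a non-zero element (flatness is only needed for
the injectivity of `S'' ⊗ T → S'' ⊗ M`, `torsionBaseChangeEquiv`). [folklore] -/
theorem torsion_baseChange_eq_range :
    Submodule.torsion S'' (S'' ⊗[S] M) =
      LinearMap.range ((Submodule.torsion S M).subtype.baseChange S'') := by
  set T := Submodule.torsion S M
  apply le_antisymm
  · -- an `S''`-torsion element maps to a torsion element of the free module `S'' ⊗ (M/T)`, so to 0
    intro x hx
    have hexact : Function.Exact (T.subtype.lTensor S'') (T.mkQ.lTensor S'') :=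
      lTensor_exact S'' (LinearMap.exact_subtype_mkQ T) (Submodule.mkQ_surjective T)
    have hx0 : T.mkQ.lTensor S'' x = 0 := by
      obtain ⟨⟨c, hc⟩, hcx⟩ := (Submodule.mem_torsion_iff x).mp hx
      have hcx' : c • (T.mkQ.baseChange S'' x) = 0 := by
        rw [← map_smul, Submonoid.mk_smul] at *
        change (T.mkQ.baseChange S'') (c • x) = 0
        rw [show c • x = 0 from hcx, map_zero]
      have hreg : IsRegular c := (le_nonZeroDivisors_iff_isRegular.mp le_rfl ⟨c, hc⟩)
      haveI : Module.Free S'' (S'' ⊗[S] (M ⧸ T)) := inferInstance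
      exact (hreg.smul_eq_zero_iff_right.mp hcx')
    obtain ⟨y, hy⟩ := (hexact x).mp hx0
    exact ⟨y, hy⟩
  · -- `S'' ⊗ T` is killed by `algebraMap a ≠ 0`
    rintro x ⟨y, rfl⟩
    obtain ⟨a, ha0, ha⟩ := exists_ne_zero_forall_smul_torsion_eq_zero (S := S) (M := M)
    refine (Submodule.mem_torsion_iff _).mpr ⟨⟨algebraMap S S'' a,
      mem_nonZeroDivisors_of_ne_zero ((map_ne_zero_iff _ hinj).mpr ha0)⟩, ?_⟩
    rw [Submonoid.mk_smul, ← map_smul, algebraMap_smul]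
    suffices h : a • y = 0 by rw [h, map_zero]
    induction y using TensorProduct.induction_on with
    | zero => rw [smul_zero]
    | tmul s t => rw [TensorProduct.smul_tmul', TensorProduct.smul_tmul, ha t, TensorProduct.tmul_zero]
    | add y z hy hz => rw [smul_add, hy, hz, add_zero]

include hinj in
/-- `S'' ⊗_S tors(M) ≅ tors(S'' ⊗_S M)` under the hypotheses of `torsion_baseChange_eq_range`
(the comparison map is injective by flatness). [folklore] -/
def torsionBaseChangeEquiv [Module.Flat S S''] :
    S'' ⊗[S] Submodule.torsion S M ≃ₗ[S''] Submodule.torsion S'' (S'' ⊗[S] M) :=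
  (LinearEquiv.ofInjective ((Submodule.torsion S M).subtype.baseChange S'')
      (Module.Flat.lTensor_preserves_injective_linearMap _ (Submodule.injective_subtype _))).trans
    (LinearEquiv.ofEq _ _ (torsion_baseChange_eq_range hinj).symm)

include hinj in
/-- **Length of torsion under a flat local base change** (`S → S''` a flat local homomorphism
of local principal ideal domains, `S` injecting into `S''`):
`length_{S''} tors(S'' ⊗ M) = length_S tors(M) · length_{S''}(S''/𝔪_S S'')` (Mathlib
`IsLocalRing.length_baseChange`). [folklore] -/
theorem length_torsion_baseChange [Module.Flat S S''] [IsLocalRing S] [IsLocalRing S'']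
    [IsLocalHom (algebraMap S S'')] :
    Module.length S'' (Submodule.torsion S'' (S'' ⊗[S] M)) =
      Module.length S (Submodule.torsion S M) *
        Module.length S'' (S'' ⧸ (maximalIdeal S).map (algebraMap S S'')) := by
  rw [← (torsionBaseChangeEquiv hinj (M := M)).length_eq, IsLocalRing.length_baseChange]

end BaseChange

/-! ### Consequences for `δ` -/

section Defect

variable (R : Type u) [CommRing R] (A : Type v) [CommRing A] [Algebra R A]
  (R' : Type w) [CommRing R'] [IsDomain R'] [Algebra A R']

/-- **`δ(a) = 0` iff `a*Ω¹_{X/R}` is free**, for `R'` a principal ideal domain (e.g. a discrete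
valuation ring) and `Ω[A⁄R]` finitely generated (e.g. `A` essentially of finite type over `R`).
(BLR 3.3, proof of Lemma 3.3/1: `a*Ω¹` is free iff its torsion vanishes.) [cite: Artin1986NeronModels, (3.8) (p. 226)] -/
theorem neronDefect_eq_zero_iff_free [IsPrincipalIdealRing R'] [Module.Finite A Ω[A⁄R]] :
    neronDefect R A R' = 0 ↔ Module.Free R' (R' ⊗[A] Ω[A⁄R]) := by
  rw [neronDefect_eq_zero_iff, free_iff_torsion_eq_bot]

/-- **`δ(a)` is finite** for `R'` a discrete valuation ring and `Ω[A⁄R]` finitely generated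
(Artin (3.8): `l(x')` "is bounded above"; here only finiteness at each point). [cite: Artin1986NeronModels, (3.8) (p. 226)] -/
theorem neronDefect_ne_top [IsDiscreteValuationRing R'] [Module.Finite A Ω[A⁄R]] :
    neronDefect R A R' ≠ ⊤ :=
  length_torsion_ne_top

variable (R'' : Type w') [CommRing R''] [IsDomain R''] [Algebra R' R''] [Algebra A R'']
  [IsScalarTower A R' R''] [Module.Flat R' R'']

/-- `a''*Ω = R'' ⊗_{R'} a*Ω` for the composite point `a'' : A → R' → R''`. [folklore] -/
def tensorKaehlerEquivOfTower : R'' ⊗[A] Ω[A⁄R] ≃ₗ[R''] R'' ⊗[R'] (R' ⊗[A] Ω[A⁄R]) :=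
  (TensorProduct.AlgebraTensorModule.cancelBaseChange A R' R'' R'' Ω[A⁄R]).symm

/-- **`δ` under a flat local extension of the point ring**: for `R' → R''` a flat local
homomorphism of local principal ideal domains (injective) and the composite point
`a'' : A → R' → R''`, `δ(a'') = δ(a) · length(R''/𝔪'R'')`. [folklore] -/
theorem neronDefect_baseChange [IsPrincipalIdealRing R'] [IsLocalRing R'] [IsLocalRing R'']
    [IsLocalHom (algebraMap R' R'')] [Module.Finite A Ω[A⁄R]]
    (hinj : Function.Injective (algebraMap R' R'')) :
    neronDefect R A R'' =
      neronDefect R A R' * Module.length R'' (R'' ⧸ (maximalIdeal R').map (algebraMap R' R'')) := by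
  rw [neronDefect_eq_of_linearEquiv (tensorKaehlerEquivOfTower R A R' R''), neronDefect]
  exact length_torsion_baseChange hinj

/-- **`δ` is invariant under extensions of ramification index one** (BLR §3.3: the defect of
smoothness may be computed after passing from `R'` to a flat local extension `R''` with
`𝔪' R'' = 𝔪''`, such as the strict henselisation or the completion): then
`length(R''/𝔪'R'') = 1` and `δ(a'') = δ(a)`. [cite: Artin1986NeronModels, (3.8) (p. 226)] -/
theorem neronDefect_eq_of_map_maximalIdeal_eq [IsPrincipalIdealRing R'] [IsLocalRing R']
    [IsLocalRing R''] [IsLocalHom (algebraMap R' R'')] [Module.Finite A Ω[A⁄R]]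
    (hinj : Function.Injective (algebraMap R' R''))
    (he : (maximalIdeal R').map (algebraMap R' R'') = maximalIdeal R'') :
    neronDefect R A R'' = neronDefect R A R' := by
  rw [neronDefect_baseChange R A R' R'' hinj, he]
  haveI : IsSimpleModule R'' (R'' ⧸ maximalIdeal R'') :=
    (isSimpleModule_iff_quot_maximal (R := R'') (M := R'' ⧸ maximalIdeal R'')).mpr
      ⟨maximalIdeal R'', inferInstance, ⟨LinearEquiv.refl _ _⟩⟩
  rw [Module.length_eq_one, mul_one]

end Defect

end Literature.AlgebraicGeometry.Smoothening

end
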